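import Literature.Analysis.FluidPDE.ElgindiPolarEnergyWeighted
import Literature.Analysis.FluidPDE.ElgindiPolarEnergyTwo
import HarnessLib

/-!
# The radially weighted second energy identity of the polar model operator ([Elgindi2021] §7.3,
Proposition 7.7 Step 1, the multiplier `−∂_θθΨ·w²`)

Topic `Literature/Analysis/FluidPDE`. Proof file (everything proved, no definitions, no named
facts) on the proof path of the named fact
`Literature.Analysis.FluidPDE.Elgindi.ElgindiGhoulMasmoudi2021_stabilityCore`
(`ElgindiStabilityDecomposition.lean`). T. M. Elgindi, Ann. of Math. 194 (2021) =
arXiv:1904.04795, §7.3 proof of Proposition 7.7, Step 1 (p. 21):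

> "Now the proof follows the same as before to give:
> `α²|R²∂_RRΨw|_{L²} + |∂_θθΨw|_{L²} ≤ C₁|Fw|_{L²}`."

"The same as before" is the multiplier `−∂_θθΨ`, now with the radial weight `W = w²`: for a weight
`W ∈ C²((0,∞))`, `Ψ = cosθ·χ` with `χ ∈ C³(ℝ²)` compactly supported inside `R > 0` and
`χ(R,0) = 0`, and any real `α` (`integral_strip_ellipticOp_mul_neg_dθdθ_weight`):
`∫∫L(Ψ)(−Ψ_θθ)W = α²∫∫W(RΨ_{Rθ})² − (α²/2)∫∫(R²W)″Ψ_θ² + (α(5+α)/2)∫∫(RW)′Ψ_θ² + ∫∫WΨ_θθ² +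
(3/2)∫∫Wχ_θ² + ½∫∫Wχ² − 6∫∫WΨ_θ²`.
-/

noncomputable section

open MeasureTheory Set Real Filter Function intervalIntegral
open _root_.Topology

namespace Literature.Analysis.FluidPDE

namespace Elgindi

/-- **The radially weighted second energy identity** (Proposition 7.7 Step 1, "the same as before"
with the weight `W`). [cite: Elgindi2021, §7.3 proof of Proposition 7.7, Step 1 (p. 21 of arXiv:1904.04795)] -/
theorem integral_strip_ellipticOp_mul_neg_dθdθ_weight (α : ℝ) {W : ℝ → ℝ} (hW : ContDiffOn ℝ 2 W (Ioi 0))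
    {χ : ℝ → ℝ → ℝ} (hχ : ContDiff ℝ 3 (uncurry χ)) (hs : HasCompactSupport (uncurry χ))
    (hpos : ∀ p ∈ tsupport (uncurry χ), 0 < p.1) (hχ0 : ∀ R, χ R 0 = 0) {Ψ : ℝ → ℝ → ℝ}
    (hΨ : Ψ = fun R θ => Real.cos θ * χ R θ) :
    ∫ p in strip, ellipticOp α Ψ p.1 p.2 * (-dθ (dθ Ψ) p.1 p.2) * W p.1 =
      α ^ 2 * (∫ p in strip, W p.1 * (p.1 * dz (dθ Ψ) p.1 p.2) ^ 2) -
        α ^ 2 / 2 * (∫ p in strip, deriv (deriv fun R => R ^ 2 * W R) p.1 * dθ Ψ p.1 p.2 ^ 2) +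
        α * (5 + α) / 2 * (∫ p in strip, deriv (fun R => R * W R) p.1 * dθ Ψ p.1 p.2 ^ 2) +
        (∫ p in strip, W p.1 * dθ (dθ Ψ) p.1 p.2 ^ 2) + (3 / 2) * (∫ p in strip, W p.1 * dθ χ p.1 p.2 ^ 2) +
        (1 / 2) * (∫ p in strip, W p.1 * χ p.1 p.2 ^ 2) - 6 * ∫ p in strip, W p.1 * dθ Ψ p.1 p.2 ^ 2 := by
  -- weights
  set M : ℝ → ℝ := fun R => R ^ 2 * W R with hM
  set N : ℝ → ℝ := fun R => R * W R with hN
  have hMd : ContDiffOn ℝ 2 M (Ioi 0) := (contDiffOn_id.pow 2).mul hW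
  have hNd : ContDiffOn ℝ 1 N (Ioi 0) := contDiffOn_id.mul (hW.of_le (by norm_num))
  have hWc : ContinuousOn W (Ioi 0) := hW.continuousOn
  have hM1 : ContDiffOn ℝ 1 (deriv M) (Ioi 0) := hMd.deriv_of_isOpen (m := 1) isOpen_Ioi (by norm_num)
  have hM2c : ContinuousOn (deriv (deriv M)) (Ioi 0) := (hM1.deriv_of_isOpen (m := 0) isOpen_Ioi (by norm_num)).continuousOn
  have hN1c : ContinuousOn (deriv N) (Ioi 0) := (hNd.deriv_of_isOpen (m := 0) isOpen_Ioi (by norm_num)).continuousOn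
  have hMc : ContinuousOn M (Ioi 0) := hMd.continuousOn
  have hNc : ContinuousOn N (Ioi 0) := hNd.continuousOn
  -- regularity
  have hχ2 : ContDiff ℝ 2 (uncurry χ) := hχ.of_le (by norm_num)
  have hχ1 : ContDiff ℝ 1 (uncurry χ) := hχ.of_le (by norm_num)
  have hΨ3 : ContDiff ℝ 3 (uncurry Ψ) := by rw [hΨ]; exact contDiff_cosProfile hχ
  have hΨ2 : ContDiff ℝ 2 (uncurry Ψ) := hΨ3.of_le (by norm_num)
  have hΨs : HasCompactSupport (uncurry Ψ) := by rw [hΨ]; exact hasCompactSupport_cosProfile hs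
  have hdzΨ : ContDiff ℝ 2 (uncurry (dz Ψ)) := contDiff_dz_of_contDiff (n := 2) hΨ3
  have hdz2Ψ : ContDiff ℝ 1 (uncurry (dz (dz Ψ))) := contDiff_dz_of_contDiff (n := 1) hdzΨ
  have hdθΨ : ContDiff ℝ 2 (uncurry (dθ Ψ)) := contDiff_dθ_of_contDiff (n := 2) hΨ3
  have hdθ2Ψ : ContDiff ℝ 1 (uncurry (dθ (dθ Ψ))) := contDiff_dθ_of_contDiff (n := 1) hdθΨ
  have hdzdθΨ : ContDiff ℝ 1 (uncurry (dz (dθ Ψ))) := contDiff_dz_of_contDiff (n := 1) hdθΨ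
  have hdθχ : ContDiff ℝ 2 (uncurry (dθ χ)) := contDiff_dθ_of_contDiff (n := 2) hχ
  have hdθ2χ : ContDiff ℝ 1 (uncurry (dθ (dθ χ))) := contDiff_dθ_of_contDiff (n := 1) hdθχ
  have hdθΨs : HasCompactSupport (uncurry (dθ Ψ)) := hasCompactSupport_dθ_of hΨs
  have hdθ2Ψs : HasCompactSupport (uncurry (dθ (dθ Ψ))) := hasCompactSupport_dθ_of hdθΨs
  have hdzdθΨs : HasCompactSupport (uncurry (dz (dθ Ψ))) := hasCompactSupport_dz hdθΨs
  have hdθχs : HasCompactSupport (uncurry (dθ χ)) := hasCompactSupport_dθ_of hs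
  have cΨ : Continuous fun p : ℝ × ℝ => Ψ p.1 p.2 := hΨ3.continuous
  have cχ : Continuous fun p : ℝ × ℝ => χ p.1 p.2 := hχ.continuous
  have cdz : Continuous fun p : ℝ × ℝ => dz Ψ p.1 p.2 := hdzΨ.continuous
  have cdz2 : Continuous fun p : ℝ × ℝ => dz (dz Ψ) p.1 p.2 := hdz2Ψ.continuous
  have cdθ : Continuous fun p : ℝ × ℝ => dθ Ψ p.1 p.2 := hdθΨ.continuous
  have cdθ2 : Continuous fun p : ℝ × ℝ => dθ (dθ Ψ) p.1 p.2 := hdθ2Ψ.continuous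
  have cdzdθ : Continuous fun p : ℝ × ℝ => dz (dθ Ψ) p.1 p.2 := hdzdθΨ.continuous
  have cdz2dθ : Continuous fun p : ℝ × ℝ => dz (dz (dθ Ψ)) p.1 p.2 := continuous_dz hdzdθΨ
  have cdθdz2 : Continuous fun p : ℝ × ℝ => dθ (dz (dz Ψ)) p.1 p.2 := (contDiff_dθ_of_contDiff (n := 0) hdz2Ψ).continuous
  have cdθdz : Continuous fun p : ℝ × ℝ => dθ (dz Ψ) p.1 p.2 := (contDiff_dθ_of_contDiff (n := 1) hdzΨ).continuous
  have cdθχ : Continuous fun p : ℝ × ℝ => dθ χ p.1 p.2 := hdθχ.continuous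
  have cdθ2χ : Continuous fun p : ℝ × ℝ => dθ (dθ χ) p.1 p.2 := hdθ2χ.continuous
  -- vanishing near the axis
  obtain ⟨a, ha, hva⟩ := exists_pos_forall_fst_lt_eq_zero hs hpos
  have hvaχ : ∀ p : ℝ × ℝ, p.1 < a → χ p.1 p.2 = 0 := fun p hp => hva p hp
  have hvaΨ : ∀ p : ℝ × ℝ, p.1 < a → Ψ p.1 p.2 = 0 := fun p hp => by rw [hΨ]; simp [hvaχ p hp]
  have hopen : IsOpen {q : ℝ × ℝ | q.1 < a} := isOpen_lt continuous_fst continuous_const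
  have vanish_of : ∀ (G : ℝ × ℝ → ℝ), (∀ p : ℝ × ℝ, p.1 < a → G p = 0) → ∀ p : ℝ × ℝ, p.1 < a →
      dθ (fun R θ => G (R, θ)) p.1 p.2 = 0 ∧ dz (fun R θ => G (R, θ)) p.1 p.2 = 0 := by
    intro G hG p hp
    constructor
    · show deriv (fun θ' => G (p.1, θ')) p.2 = 0
      have : (fun θ' => G (p.1, θ')) = fun _ => 0 := funext fun θ' => hG (p.1, θ') hp
      rw [this, deriv_const]
    · show deriv (fun R' => G (R', p.2)) p.1 = 0
      have : (fun R' => G (R', p.2)) =ᶠ[𝓝 p.1] fun _ => 0 :=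
        Filter.eventuallyEq_of_mem (Iio_mem_nhds hp) fun R' hR' => hG (R', p.2) hR'
      rw [this.deriv_eq, deriv_const]
  have hvadθ : ∀ p : ℝ × ℝ, p.1 < a → dθ Ψ p.1 p.2 = 0 := fun p hp => (vanish_of (fun q => Ψ q.1 q.2) hvaΨ p hp).1
  have hvadz : ∀ p : ℝ × ℝ, p.1 < a → dz Ψ p.1 p.2 = 0 := fun p hp => (vanish_of (fun q => Ψ q.1 q.2) hvaΨ p hp).2
  have hvadθ2 : ∀ p : ℝ × ℝ, p.1 < a → dθ (dθ Ψ) p.1 p.2 = 0 := fun p hp => (vanish_of (fun q => dθ Ψ q.1 q.2) hvadθ p hp).1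
  have hvadzdθ : ∀ p : ℝ × ℝ, p.1 < a → dz (dθ Ψ) p.1 p.2 = 0 := fun p hp => (vanish_of (fun q => dθ Ψ q.1 q.2) hvadθ p hp).2
  have hvadz2 : ∀ p : ℝ × ℝ, p.1 < a → dz (dz Ψ) p.1 p.2 = 0 := fun p hp => (vanish_of (fun q => dz Ψ q.1 q.2) hvadz p hp).2
  have hvadθdz : ∀ p : ℝ × ℝ, p.1 < a → dθ (dz Ψ) p.1 p.2 = 0 := fun p hp => (vanish_of (fun q => dz Ψ q.1 q.2) hvadz p hp).1
  have hvadθdz2 : ∀ p : ℝ × ℝ, p.1 < a → dθ (dz (dz Ψ)) p.1 p.2 = 0 := fun p hp => (vanish_of (fun q => dz (dz Ψ) q.1 q.2) hvadz2 p hp).1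
  have hvadz2dθ : ∀ p : ℝ × ℝ, p.1 < a → dz (dz (dθ Ψ)) p.1 p.2 = 0 := fun p hp => (vanish_of (fun q => dz (dθ Ψ) q.1 q.2) hvadzdθ p hp).2
  have hvadθχ : ∀ p : ℝ × ℝ, p.1 < a → dθ χ p.1 p.2 = 0 := fun p hp => (vanish_of (fun q => χ q.1 q.2) hvaχ p hp).1
  -- Dirichlet data and the horizontal-line radial derivatives
  have hD0 : ∀ R, Ψ R 0 = 0 := fun R => by rw [hΨ]; simp [hχ0 R]
  have hD1 : ∀ R, Ψ R (π / 2) = 0 := fun R => by rw [hΨ]; simp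
  have hdz0 : ∀ R, dz Ψ R 0 = 0 := dz_eq_zero_of_forall hD0
  have hdz1 : ∀ R, dz Ψ R (π / 2) = 0 := dz_eq_zero_of_forall hD1
  have hdzz0 : ∀ R, dz (dz Ψ) R 0 = 0 := dz_eq_zero_of_forall hdz0
  have hdzz1 : ∀ R, dz (dz Ψ) R (π / 2) = 0 := dz_eq_zero_of_forall hdz1
  -- the integrands
  set A : ℝ × ℝ → ℝ := fun p => M p.1 * (dz (dz Ψ) p.1 p.2 * dθ (dθ Ψ) p.1 p.2) with hA
  set A' : ℝ × ℝ → ℝ := fun p => M p.1 * (dθ (dz (dz Ψ)) p.1 p.2 * dθ Ψ p.1 p.2) with hA'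
  set A'' : ℝ × ℝ → ℝ := fun p => M p.1 * (dz (dz (dθ Ψ)) p.1 p.2 * dθ Ψ p.1 p.2) with hA''
  set Bf : ℝ × ℝ → ℝ := fun p => N p.1 * (dz Ψ p.1 p.2 * dθ (dθ Ψ) p.1 p.2) with hBf
  set B' : ℝ × ℝ → ℝ := fun p => N p.1 * (dθ (dz Ψ) p.1 p.2 * dθ Ψ p.1 p.2) with hB'
  set B'' : ℝ × ℝ → ℝ := fun p => N p.1 * (dz (dθ Ψ) p.1 p.2 * dθ Ψ p.1 p.2) with hB''
  set C : ℝ × ℝ → ℝ := fun p => W p.1 * dθ (dθ Ψ) p.1 p.2 ^ 2 with hC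
  set D : ℝ × ℝ → ℝ := fun p => W p.1 * ((Real.cos p.2 * χ p.1 p.2 + Real.sin p.2 * dθ χ p.1 p.2) *
    (Real.cos p.2 * χ p.1 p.2 + 2 * Real.sin p.2 * dθ χ p.1 p.2 - Real.cos p.2 * dθ (dθ χ) p.1 p.2)) with hD
  set E : ℝ × ℝ → ℝ := fun p => W p.1 * (6 * (Ψ p.1 p.2 * dθ (dθ Ψ) p.1 p.2)) with hE
  set Y : ℝ × ℝ → ℝ := fun p => W p.1 * dθ Ψ p.1 p.2 ^ 2 with hY
  set Z : ℝ × ℝ → ℝ := fun p => W p.1 * (p.1 * dz (dθ Ψ) p.1 p.2) ^ 2 with hZ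
  set M2 : ℝ × ℝ → ℝ := fun p => deriv (deriv M) p.1 * dθ Ψ p.1 p.2 ^ 2 with hM2
  set N1 : ℝ × ℝ → ℝ := fun p => deriv N p.1 * dθ Ψ p.1 p.2 ^ 2 with hN1
  set X : ℝ × ℝ → ℝ := fun p => W p.1 * χ p.1 p.2 ^ 2 with hX
  set Xθ : ℝ × ℝ → ℝ := fun p => W p.1 * dθ χ p.1 p.2 ^ 2 with hXθ
  -- continuity and compact support
  have cA : Continuous A := continuous_weight_mul₂ hMc (cdz2.mul cdθ2) ha fun p hp => by simp [hvadθ2 p hp]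
  have cA' : Continuous A' := continuous_weight_mul₂ hMc (cdθdz2.mul cdθ) ha fun p hp => by simp [hvadθ p hp]
  have cA'' : Continuous A'' := continuous_weight_mul₂ hMc (cdz2dθ.mul cdθ) ha fun p hp => by simp [hvadθ p hp]
  have cB : Continuous Bf := continuous_weight_mul₂ hNc (cdz.mul cdθ2) ha fun p hp => by simp [hvadθ2 p hp]
  have cB' : Continuous B' := continuous_weight_mul₂ hNc (cdθdz.mul cdθ) ha fun p hp => by simp [hvadθ p hp]
  have cB'' : Continuous B'' := continuous_weight_mul₂ hNc (cdzdθ.mul cdθ) ha fun p hp => by simp [hvadθ p hp]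
  have cC : Continuous C := continuous_weight_mul₂ hWc (cdθ2.pow 2) ha fun p hp => by simp [hvadθ2 p hp]
  have cD : Continuous D := continuous_weight_mul₂ hWc (by fun_prop) ha fun p hp => by simp [hvaχ p hp, hvadθχ p hp]
  have cE : Continuous E := continuous_weight_mul₂ hWc (by fun_prop) ha fun p hp => by simp [hvaΨ p hp]
  have cY : Continuous Y := continuous_weight_mul₂ hWc (cdθ.pow 2) ha fun p hp => by simp [hvadθ p hp]
  have cZ : Continuous Z := continuous_weight_mul₂ hWc (by fun_prop) ha fun p hp => by simp [hvadzdθ p hp]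
  have cM2 : Continuous M2 := continuous_weight_mul₂ hM2c (cdθ.pow 2) ha fun p hp => by simp [hvadθ p hp]
  have cN1 : Continuous N1 := continuous_weight_mul₂ hN1c (cdθ.pow 2) ha fun p hp => by simp [hvadθ p hp]
  have cX : Continuous X := continuous_weight_mul₂ hWc (cχ.pow 2) ha fun p hp => by simp [hvaχ p hp]
  have cXθ : Continuous Xθ := continuous_weight_mul₂ hWc (cdθχ.pow 2) ha fun p hp => by simp [hvadθχ p hp]
  have supp_of : ∀ (F : ℝ × ℝ → ℝ) (g : ℝ × ℝ → ℝ), HasCompactSupport g → (∀ p, g p = 0 → F p = 0) → HasCompactSupport F :=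
    fun F g hg h => hg.mono fun p hp => by
      contrapose! hp
      simp only [mem_support, ne_eq, not_not] at hp ⊢
      exact h p hp
  have sθ : HasCompactSupport fun p : ℝ × ℝ => dθ Ψ p.1 p.2 := hdθΨs
  have sθ2 : HasCompactSupport fun p : ℝ × ℝ => dθ (dθ Ψ) p.1 p.2 := hdθ2Ψs
  have sA : HasCompactSupport A := supp_of A _ sθ2 fun p hp => by simp only [hA]; simp [show dθ (dθ Ψ) p.1 p.2 = 0 from hp]
  have sA' : HasCompactSupport A' := supp_of A' _ sθ fun p hp => by simp only [hA']; simp [show dθ Ψ p.1 p.2 = 0 from hp]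
  have sA'' : HasCompactSupport A'' := supp_of A'' _ sθ fun p hp => by simp only [hA'']; simp [show dθ Ψ p.1 p.2 = 0 from hp]
  have sB : HasCompactSupport Bf := supp_of Bf _ sθ2 fun p hp => by simp only [hBf]; simp [show dθ (dθ Ψ) p.1 p.2 = 0 from hp]
  have sB' : HasCompactSupport B' := supp_of B' _ sθ fun p hp => by simp only [hB']; simp [show dθ Ψ p.1 p.2 = 0 from hp]
  have sB'' : HasCompactSupport B'' := supp_of B'' _ sθ fun p hp => by simp only [hB'']; simp [show dθ Ψ p.1 p.2 = 0 from hp]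
  have sC : HasCompactSupport C := supp_of C _ sθ2 fun p hp => by simp only [hC]; simp [show dθ (dθ Ψ) p.1 p.2 = 0 from hp]
  have sD : HasCompactSupport D := by
    refine supp_of D (fun p => (Real.cos p.2 * χ p.1 p.2 + Real.sin p.2 * dθ χ p.1 p.2)) ?_ fun p hp => by
      simp only [hD]; simp [show Real.cos p.2 * χ p.1 p.2 + Real.sin p.2 * dθ χ p.1 p.2 = 0 from hp]
    exact (hs.mul_left).add (hdθχs.mul_left)
  have sE : HasCompactSupport E := supp_of E _ sθ2 fun p hp => by simp only [hE]; simp [show dθ (dθ Ψ) p.1 p.2 = 0 from hp]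
  have sY : HasCompactSupport Y := supp_of Y _ sθ fun p hp => by simp only [hY]; simp [show dθ Ψ p.1 p.2 = 0 from hp]
  have sZ : HasCompactSupport Z := supp_of Z _ hdzdθΨs fun p hp => by simp only [hZ]; simp [show dz (dθ Ψ) p.1 p.2 = 0 from hp]
  have sM2 : HasCompactSupport M2 := supp_of M2 _ sθ fun p hp => by simp only [hM2]; simp [show dθ Ψ p.1 p.2 = 0 from hp]
  have sN1 : HasCompactSupport N1 := supp_of N1 _ sθ fun p hp => by simp only [hN1]; simp [show dθ Ψ p.1 p.2 = 0 from hp]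
  have sX : HasCompactSupport X := supp_of X _ hs fun p hp => by simp only [hX]; simp [show χ p.1 p.2 = 0 from hp]
  have sXθ : HasCompactSupport Xθ := supp_of Xθ _ hdθχs fun p hp => by simp only [hXθ]; simp [show dθ χ p.1 p.2 = 0 from hp]
  have iA : Integrable A := cA.integrable_of_hasCompactSupport sA
  have iA' : Integrable A' := cA'.integrable_of_hasCompactSupport sA'
  have iA'' : Integrable A'' := cA''.integrable_of_hasCompactSupport sA''
  have iB : Integrable Bf := cB.integrable_of_hasCompactSupport sB
  have iB' : Integrable B' := cB'.integrable_of_hasCompactSupport sB'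
  have iB'' : Integrable B'' := cB''.integrable_of_hasCompactSupport sB''
  have iC : Integrable C := cC.integrable_of_hasCompactSupport sC
  have iD : Integrable D := cD.integrable_of_hasCompactSupport sD
  have iE : Integrable E := cE.integrable_of_hasCompactSupport sE
  have iY : Integrable Y := cY.integrable_of_hasCompactSupport sY
  have iZ : Integrable Z := cZ.integrable_of_hasCompactSupport sZ
  have iM2 : Integrable M2 := cM2.integrable_of_hasCompactSupport sM2
  have iN1 : Integrable N1 := cN1.integrable_of_hasCompactSupport sN1
  have iX : Integrable X := cX.integrable_of_hasCompactSupport sX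
  have iXθ : Integrable Xθ := cXθ.integrable_of_hasCompactSupport sXθ
  -- generic tools
  have sliceR_supp : ∀ (G : ℝ × ℝ → ℝ), HasCompactSupport G → ∀ θ : ℝ, HasCompactSupport fun R => G (R, θ) :=
    fun G hG θ => HasCompactSupport.of_support_subset_isCompact (hG.image continuous_fst) fun R hR =>
      ⟨(R, θ), subset_tsupport G hR, rfl⟩
  have vanishR : ∀ (G : ℝ × ℝ → ℝ), Integrable G → (∀ θ ∈ Ioo 0 (π / 2), ∫ R in Ioi (0 : ℝ), G (R, θ) = 0) →
      ∫ p in strip, G p = 0 := fun G hG h => by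
    rw [integral_strip_eq_integral_Ioo_integral_Ioi hG]; exact setIntegral_eq_zero_of_forall_eq_zero h
  have vanishθ : ∀ (G : ℝ × ℝ → ℝ), Integrable G → (∀ R ∈ Ioi (0 : ℝ), ∫ θ in Ioo 0 (π / 2), G (R, θ) = 0) →
      ∫ p in strip, G p = 0 := fun G hG h => by
    rw [integral_strip_eq_integral_Ioi_integral_Ioo hG]; exact setIntegral_eq_zero_of_forall_eq_zero h
  have intR : ∀ (G : ℝ × ℝ → ℝ), Continuous G → HasCompactSupport G → ∀ θ, Integrable fun R => G (R, θ) :=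
    fun G hG hGs θ => (hG.comp (Continuous.prodMk_left θ)).integrable_of_hasCompactSupport (sliceR_supp G hGs θ)
  have intθ : ∀ (G : ℝ × ℝ → ℝ), Continuous G → ∀ R, IntegrableOn (fun θ => G (R, θ)) (Ioo 0 (π / 2)) :=
    fun G hG R => ((hG.comp (Continuous.prodMk_right R)).continuousOn.integrableOn_Icc (a := 0) (b := π / 2)).mono_set
      Ioo_subset_Icc_self
  have toIoo : ∀ (g : ℝ → ℝ), ∫ θ in (0 : ℝ)..(π / 2), g θ = ∫ θ in Ioo 0 (π / 2), g θ := fun g => by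
    rw [intervalIntegral.integral_of_le (by positivity), integral_Ioc_eq_integral_Ioo]
  -- slices
  have huθ : ∀ R, ContDiff ℝ 2 fun θ => Ψ R θ := fun R => hΨ2.comp (contDiff_const.prodMk contDiff_id)
  have hχθ : ∀ R, ContDiff ℝ 2 fun θ => χ R θ := fun R => hχ2.comp (contDiff_const.prodMk contDiff_id)
  have hwzz : ∀ R, ContDiff ℝ 1 fun θ => dz (dz Ψ) R θ := fun R => hdz2Ψ.comp (contDiff_const.prodMk contDiff_id)
  have hwz : ∀ R, ContDiff ℝ 1 fun θ => dz Ψ R θ := fun R => (hdzΨ.comp (contDiff_const.prodMk contDiff_id)).of_le (by norm_num)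
  have hvR : ∀ θ, ContDiff ℝ 2 fun R => dθ Ψ R θ := fun θ => hdθΨ.comp (contDiff_id.prodMk contDiff_const)
  have hdu : ∀ R, deriv (fun θ => Ψ R θ) = fun θ => dθ Ψ R θ := fun R => rfl
  have hddu : ∀ R, deriv (deriv fun θ => Ψ R θ) = fun θ => dθ (dθ Ψ) R θ := fun R => by rw [hdu R]; rfl
  have hdwzz : ∀ R, deriv (fun θ => dz (dz Ψ) R θ) = fun θ => dθ (dz (dz Ψ)) R θ := fun R => rfl
  have hdwz : ∀ R, deriv (fun θ => dz Ψ R θ) = fun θ => dθ (dz Ψ) R θ := fun R => rfl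
  have hdχ : ∀ R, deriv (fun θ => χ R θ) = fun θ => dθ χ R θ := fun R => rfl
  have hddχ : ∀ R, deriv (deriv fun θ => χ R θ) = fun θ => dθ (dθ χ) R θ := fun R => by rw [hdχ R]; rfl
  have hdv : ∀ θ, deriv (fun R => dθ Ψ R θ) = fun R => dz (dθ Ψ) R θ := fun θ => rfl
  have hddv : ∀ θ, deriv (deriv fun R => dθ Ψ R θ) = fun R => dz (dz (dθ Ψ)) R θ := fun θ => by rw [hdv θ]; rfl
  have hvs : ∀ θ, HasCompactSupport fun R => dθ Ψ R θ := fun θ => sliceR_supp (fun p => dθ Ψ p.1 p.2) sθ θ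
  have hvsub : ∀ θ, tsupport (fun R => dθ Ψ R θ) ⊆ Ioi 0 := by
    intro θ
    refine (closure_minimal (fun R hR => ?_) isClosed_Ici).trans (Ici_subset_Ioi.2 ha)
    by_contra h
    exact hR (hvadθ (R, θ) (not_le.1 h))
  have hcomm1 : ∀ p ∈ strip, dθ (dz Ψ) p.1 p.2 = dz (dθ Ψ) p.1 p.2 := fun p hp => dθ_dz_eq_dz_dθ hΨ2.contDiffOn hp
  have hcomm2 : ∀ p ∈ strip, dθ (dz (dz Ψ)) p.1 p.2 = dz (dz (dθ Ψ)) p.1 p.2 := by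
    intro p hp
    rw [dθ_dz_eq_dz_dθ hdzΨ.contDiffOn hp]
    exact dz_congr hcomm1 hp
  -- pointwise on the strip
  have hpt : ∀ p ∈ strip, ellipticOp α Ψ p.1 p.2 * (-dθ (dθ Ψ) p.1 p.2) * W p.1 =
      α ^ 2 * A p + α * (5 + α) * Bf p + C p + D p + E p := by
    intro p hp
    have hcos : Real.cos p.2 ≠ 0 := (Real.cos_pos_of_mem_Ioo ⟨by linarith [hp.2.1, Real.pi_pos], hp.2.2⟩).ne'
    have hT : Real.cos p.2 * χ p.1 p.2 / Real.cos p.2 ^ 2 +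
        Real.sin p.2 * (-Real.sin p.2 * χ p.1 p.2 + Real.cos p.2 * dθ χ p.1 p.2) / Real.cos p.2 =
        Real.cos p.2 * χ p.1 p.2 + Real.sin p.2 * dθ χ p.1 p.2 := by
      rw [div_add_div _ _ (pow_ne_zero 2 hcos) hcos, div_eq_iff (mul_ne_zero (pow_ne_zero 2 hcos) hcos)]
      have := Real.sin_sq_add_cos_sq p.2
      linear_combination (-(Real.cos p.2 ^ 2 * χ p.1 p.2)) * this
    have hΨp : Ψ p.1 p.2 / Real.cos p.2 ^ 2 = Real.cos p.2 * χ p.1 p.2 / Real.cos p.2 ^ 2 := by rw [hΨ]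
    have hdθp : dθ Ψ p.1 p.2 = -Real.sin p.2 * χ p.1 p.2 + Real.cos p.2 * dθ χ p.1 p.2 := by rw [hΨ, dθ_cosProfile hχ1]
    have hdθθp : dθ (dθ Ψ) p.1 p.2 = -Real.cos p.2 * χ p.1 p.2 - 2 * Real.sin p.2 * dθ χ p.1 p.2 + Real.cos p.2 * dθ (dθ χ) p.1 p.2 := by
      rw [hΨ, dθ_dθ_cosProfile hχ2]
    have hud : DifferentiableAt ℝ (fun θ' => Ψ p.1 θ') p.2 := ((huθ p.1).differentiable (by simp)) p.2
    rw [ellipticOp_eq_expanded α hud hcos]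
    simp only [hA, hBf, hC, hD, hE, hM, hN]
    rw [hdθp, hΨp, hT]
    have key : (Real.cos p.2 * χ p.1 p.2 + Real.sin p.2 * dθ χ p.1 p.2) * (-dθ (dθ Ψ) p.1 p.2) =
        (Real.cos p.2 * χ p.1 p.2 + Real.sin p.2 * dθ χ p.1 p.2) *
          (Real.cos p.2 * χ p.1 p.2 + 2 * Real.sin p.2 * dθ χ p.1 p.2 - Real.cos p.2 * dθ (dθ χ) p.1 p.2) := by
      rw [hdθθp]; ring
    linear_combination (W p.1) * key
  -- TERM A
  have hA1 : ∫ p in strip, A p = -∫ p in strip, A' p := by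
    have h0 := vanishθ (fun p => A p + A' p) (iA.add iA') (fun R _ => by
      have h1 := integral_mul_deriv2_dirichlet (hwzz R) (huθ R) (hdzz0 R) (hdzz1 R)
      rw [hddu R, hdu R, hdwzz R, toIoo, toIoo] at h1
      simp only at h1
      have j1 : IntegrableOn (fun θ => M R * (dz (dz Ψ) R θ * dθ (dθ Ψ) R θ)) (Ioo 0 (π / 2)) := intθ A cA R
      have j2 : IntegrableOn (fun θ => M R * (dθ (dz (dz Ψ)) R θ * dθ Ψ R θ)) (Ioo 0 (π / 2)) := intθ A' cA' R
      simp only [hA, hA']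
      rw [integral_add j1 j2, MeasureTheory.integral_const_mul, MeasureTheory.integral_const_mul, h1]; ring)
    rw [integral_add iA.integrableOn iA'.integrableOn] at h0
    linarith
  have hA2 : ∫ p in strip, A' p = ∫ p in strip, A'' p :=
    setIntegral_congr_fun measurableSet_strip fun p hp => by simp only [hA', hA'']; rw [hcomm2 p hp]
  have hA3 : ∫ p in strip, A'' p = -(∫ p in strip, Z p) + (1 / 2) * ∫ p in strip, M2 p := by
    have h0 := vanishR (fun p => A'' p + Z p - (1 / 2) * M2 p) ((iA''.add iZ).sub (iM2.const_mul _)) (fun θ _ => by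
      have h1 := integral_Ioi_neg_weight_mul_deriv2_mul hMd (hvR θ) (hvs θ) (hvsub θ)
      rw [hddv θ, hdv θ] at h1
      simp only at h1
      have j1 : IntegrableOn (fun R => M R * (dz (dz (dθ Ψ)) R θ * dθ Ψ R θ)) (Ioi 0) := (intR A'' cA'' sA'' θ).integrableOn
      have j2 : IntegrableOn (fun R => W R * (R * dz (dθ Ψ) R θ) ^ 2) (Ioi 0) := (intR Z cZ sZ θ).integrableOn
      have j3 : IntegrableOn (fun R => (1 / 2) * (deriv (deriv M) R * dθ Ψ R θ ^ 2)) (Ioi 0) := ((intR M2 cM2 sM2 θ).const_mul _).integrableOn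
      have j12 : IntegrableOn (fun R => M R * (dz (dz (dθ Ψ)) R θ * dθ Ψ R θ) + W R * (R * dz (dθ Ψ) R θ) ^ 2) (Ioi 0) := j1.add j2
      simp only [hA'', hZ, hM2]
      rw [integral_sub j12 j3, integral_add j1 j2, MeasureTheory.integral_const_mul]
      have e1 : ∫ R in Ioi (0 : ℝ), M R * (dz (dz (dθ Ψ)) R θ * dθ Ψ R θ) = -∫ R in Ioi (0 : ℝ), -(M R * dz (dz (dθ Ψ)) R θ) * dθ Ψ R θ := by
        rw [← MeasureTheory.integral_neg]; exact integral_congr_ae (ae_of_all _ fun R => by ring)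
      have e2 : ∫ R in Ioi (0 : ℝ), W R * (R * dz (dθ Ψ) R θ) ^ 2 = ∫ R in Ioi (0 : ℝ), M R * dz (dθ Ψ) R θ ^ 2 :=
        integral_congr_ae (ae_of_all _ fun R => by simp only [hM]; ring)
      rw [e1, e2, h1]; ring)
    have k : IntegrableOn (fun p => A'' p + Z p) strip := (iA''.add iZ).integrableOn
    have k3 : IntegrableOn (fun p => (1 / 2) * M2 p) strip := (iM2.const_mul _).integrableOn
    rw [integral_sub k k3, integral_add iA''.integrableOn iZ.integrableOn, MeasureTheory.integral_const_mul] at h0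
    linarith
  -- TERM B
  have hB1 : ∫ p in strip, Bf p = -∫ p in strip, B' p := by
    have h0 := vanishθ (fun p => Bf p + B' p) (iB.add iB') (fun R _ => by
      have h1 := integral_mul_deriv2_dirichlet (hwz R) (huθ R) (hdz0 R) (hdz1 R)
      rw [hddu R, hdu R, hdwz R, toIoo, toIoo] at h1
      simp only at h1
      have j1 : IntegrableOn (fun θ => N R * (dz Ψ R θ * dθ (dθ Ψ) R θ)) (Ioo 0 (π / 2)) := intθ Bf cB R
      have j2 : IntegrableOn (fun θ => N R * (dθ (dz Ψ) R θ * dθ Ψ R θ)) (Ioo 0 (π / 2)) := intθ B' cB' R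
      simp only [hBf, hB']
      rw [integral_add j1 j2, MeasureTheory.integral_const_mul, MeasureTheory.integral_const_mul, h1]; ring)
    rw [integral_add iB.integrableOn iB'.integrableOn] at h0
    linarith
  have hB2 : ∫ p in strip, B' p = ∫ p in strip, B'' p :=
    setIntegral_congr_fun measurableSet_strip fun p hp => by simp only [hB', hB'']; rw [hcomm1 p hp]
  have hB3 : ∫ p in strip, B'' p = -((1 / 2) * ∫ p in strip, N1 p) := by
    have h0 := vanishR (fun p => B'' p + (1 / 2) * N1 p) (iB''.add (iN1.const_mul _)) (fun θ _ => by
      have h1 := integral_Ioi_neg_weight_mul_deriv_mul hNd ((hvR θ).of_le (by norm_num)) (hvs θ) (hvsub θ)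
      rw [hdv θ] at h1
      simp only at h1
      have j1 : IntegrableOn (fun R => N R * (dz (dθ Ψ) R θ * dθ Ψ R θ)) (Ioi 0) := (intR B'' cB'' sB'' θ).integrableOn
      have j3 : IntegrableOn (fun R => (1 / 2) * (deriv N R * dθ Ψ R θ ^ 2)) (Ioi 0) := ((intR N1 cN1 sN1 θ).const_mul _).integrableOn
      simp only [hB'', hN1]
      rw [integral_add j1 j3, MeasureTheory.integral_const_mul]
      have e1 : ∫ R in Ioi (0 : ℝ), N R * (dz (dθ Ψ) R θ * dθ Ψ R θ) = -∫ R in Ioi (0 : ℝ), -(N R * dz (dθ Ψ) R θ) * dθ Ψ R θ := by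
        rw [← MeasureTheory.integral_neg]; exact integral_congr_ae (ae_of_all _ fun R => by ring)
      rw [e1, h1]; ring)
    have k : IntegrableOn (fun p => (1 / 2) * N1 p) strip := (iN1.const_mul _).integrableOn
    rw [integral_add iB''.integrableOn k, MeasureTheory.integral_const_mul] at h0
    linarith
  -- TERM D
  have hTD : ∫ p in strip, D p = (3 / 2) * (∫ p in strip, Xθ p) + (1 / 2) * ∫ p in strip, X p := by
    have h0 := vanishθ (fun p => D p - (3 / 2) * Xθ p - (1 / 2) * X p) ((iD.sub (iXθ.const_mul _)).sub (iX.const_mul _)) (fun R _ => by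
      have h1 := integral_tanTerm_mul_deriv2 (hχθ R) (hχ0 R)
      rw [hddχ R, hdχ R, toIoo, toIoo, toIoo] at h1
      simp only at h1
      have j1 : IntegrableOn (fun θ => W R * ((Real.cos θ * χ R θ + Real.sin θ * dθ χ R θ) *
          (Real.cos θ * χ R θ + 2 * Real.sin θ * dθ χ R θ - Real.cos θ * dθ (dθ χ) R θ))) (Ioo 0 (π / 2)) := intθ D cD R
      have j2 : IntegrableOn (fun θ => (3 / 2) * (W R * dθ χ R θ ^ 2)) (Ioo 0 (π / 2)) := (intθ Xθ cXθ R).const_mul _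
      have j3 : IntegrableOn (fun θ => (1 / 2) * (W R * χ R θ ^ 2)) (Ioo 0 (π / 2)) := (intθ X cX R).const_mul _
      have j12 : IntegrableOn (fun θ => W R * ((Real.cos θ * χ R θ + Real.sin θ * dθ χ R θ) *
          (Real.cos θ * χ R θ + 2 * Real.sin θ * dθ χ R θ - Real.cos θ * dθ (dθ χ) R θ)) - (3 / 2) * (W R * dθ χ R θ ^ 2))
          (Ioo 0 (π / 2)) := j1.sub j2
      simp only [hD, hXθ, hX]
      rw [integral_sub j12 j3, integral_sub j1 j2, MeasureTheory.integral_const_mul, MeasureTheory.integral_const_mul,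
        MeasureTheory.integral_const_mul, MeasureTheory.integral_const_mul, MeasureTheory.integral_const_mul, h1]; ring)
    have k1 : IntegrableOn (fun p => D p - (3 / 2) * Xθ p) strip := (iD.sub (iXθ.const_mul _)).integrableOn
    have k2 : IntegrableOn (fun p => (3 / 2) * Xθ p) strip := (iXθ.const_mul _).integrableOn
    have k3 : IntegrableOn (fun p => (1 / 2) * X p) strip := (iX.const_mul _).integrableOn
    rw [integral_sub k1 k3, integral_sub iD.integrableOn k2, MeasureTheory.integral_const_mul, MeasureTheory.integral_const_mul] at h0
    linarith
  -- TERM E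
  have hTE : ∫ p in strip, E p = -6 * ∫ p in strip, Y p := by
    have h0 := vanishθ (fun p => E p + 6 * Y p) (iE.add (iY.const_mul _)) (fun R _ => by
      have h1 := integral_mul_deriv2_dirichlet ((huθ R).of_le (by norm_num)) (huθ R) (hD0 R) (hD1 R)
      rw [hddu R, hdu R, toIoo, toIoo] at h1
      simp only at h1
      have j1 : IntegrableOn (fun θ => W R * (6 * (Ψ R θ * dθ (dθ Ψ) R θ))) (Ioo 0 (π / 2)) := intθ E cE R
      have j2 : IntegrableOn (fun θ => 6 * (W R * dθ Ψ R θ ^ 2)) (Ioo 0 (π / 2)) := (intθ Y cY R).const_mul _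
      simp only [hE, hY]
      rw [integral_add j1 j2, MeasureTheory.integral_const_mul, MeasureTheory.integral_const_mul, MeasureTheory.integral_const_mul,
        MeasureTheory.integral_const_mul]
      have e2 : ∫ θ in Ioo 0 (π / 2), dθ Ψ R θ ^ 2 = ∫ θ in Ioo 0 (π / 2), dθ Ψ R θ * dθ Ψ R θ :=
        integral_congr_ae (ae_of_all _ fun θ => by ring)
      rw [e2, h1]
      ring)
    have k : IntegrableOn (fun p => 6 * Y p) strip := (iY.const_mul _).integrableOn
    rw [integral_add iE.integrableOn k, MeasureTheory.integral_const_mul] at h0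
    linarith
  -- assemble
  rw [setIntegral_congr_fun measurableSet_strip hpt]
  have i1 : IntegrableOn (fun p => α ^ 2 * A p) strip := (iA.const_mul _).integrableOn
  have i2 : IntegrableOn (fun p => α * (5 + α) * Bf p) strip := (iB.const_mul _).integrableOn
  have k12 : IntegrableOn (fun p => α ^ 2 * A p + α * (5 + α) * Bf p) strip := i1.add i2
  have k123 : IntegrableOn (fun p => α ^ 2 * A p + α * (5 + α) * Bf p + C p) strip := k12.add iC.integrableOn
  have k1234 : IntegrableOn (fun p => α ^ 2 * A p + α * (5 + α) * Bf p + C p + D p) strip := k123.add iD.integrableOn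
  rw [integral_add k1234 iE.integrableOn, integral_add k123 iD.integrableOn, integral_add k12 iC.integrableOn, integral_add i1 i2,
    MeasureTheory.integral_const_mul, MeasureTheory.integral_const_mul, hA1, hA2, hA3, hB1, hB2, hB3, hTD, hTE]
  simp only [hC, hY, hZ, hX, hXθ, hM2, hN1]
  ring

end Elgindi

end Literature.Analysis.FluidPDE
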